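import Summits.PneNP.PneNP.Theorems.CodingVolumeShiftsCodingVolumeRungs

/-!
# Route CodingVolumeShifts — crux `CodingVolume` (stmt-PneNP-19454): the stretch form of the
# volume bound, and graded networks

X = `CodingVolume` asks for `C·k ≤ m` in every `Δ`-bounded k-pairs DAG whose pairs are `L`-far and
which carries a binary one-shot code. This file proves the bound WEIGHTED BY ANY STRICT POTENTIAL and
reads off the class of networks on which X already holds with the optimal `L = C` and no degree bound.

* `codingVolume_exists_walk_lev` — levels grow along information: for a strict potential `lev`
  (`lev (src a) < lev (tgt a)` on every arc), an `x_i`-dependent arc `a` has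
  `lev (source i) + d ≤ lev (tgt a)` for the length `d` of some undirected walk from `source i` to its
  head (rank induction on `codingVolume_dep_upstream`); hence `codingVolume_lev_source_add_le`:
  `lev (source i) + L ≤ lev (sink i)` for an `L`-far pair.
* `codingVolume_sum_card_filter_Ioc` — double counting of thresholds (bookkeeping).
* `codingVolume_mul_card_le_sum_stretch` — **STRETCH BOUND**: `L·k ≤ Σ_a (lev (tgt a) − lev (src a))`.
  Proof: the cut-set bound `codingVolume_cut_bound` for every upper set `{v | ρ ≤ lev v}` counts the arcs
  crossing the threshold `ρ` against the commodities with `lev (source i) < ρ ≤ lev (sink i)`; summing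
  over `ρ` counts each arc its stretch many times and each commodity `lev (sink i) − lev (source i) ≥ L`
  times. With `lev := N.rank`: `codingVolume_mul_card_le_sum_rank_stretch`.
* `codingVolume_mul_card_le_arcCount_add_excess` — equivalently `L·k ≤ m + Σ_a (stretch a − 1)`: the
  deficit of a coded network below the routing volume `L·k` is paid for, arc by arc, by level-SKIPPING.
* `codingVolume_graded_arcs`, `codingVolume_graded` — on GRADED networks (some potential climbs exactly
  one level along every arc, e.g. layered DAGs) `L·k ≤ m`, i.e. every cell `(Δ, C)` of X holds there with
  `L = C` (optimal by `CodingVolume.Negative.codingVolume_ceiling`, whose path networks are graded):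
  a counterexample to X must use long arcs in every grading.

No definitions are introduced ("depends on `x_i`" is spelled out as in the Flow file); route-independent
(imports the Rungs file only, no Theses file).
-/

set_option linter.dupNamespace false -- `Summit.PneNP.PneNP.…`: summit = sub-problem name (D-0017)

namespace Summit.PneNP.PneNP.Theorems

open Literature.InformationTheory.NetworkCoding Finset

section Graded

variable {ι : Type} {N : KPairsNet ι}

/-- LEVELS GROW ALONG INFORMATION. For a strict potential `lev` on the vertices (increasing along every
arc) and an arc `a` whose bit depends on `x_i`, some undirected walk from `source i` to the head of `a`
has length `d` with `lev (source i) + d ≤ lev (head a)`: follow the `x_i`-dependent arcs upstream to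
`source i` (`codingVolume_dep_upstream`, rank induction); each of them climbs at least one level.
[folklore] -/
theorem codingVolume_exists_walk_lev (lev : N.V → ℕ) (hlev : ∀ a, lev (N.src a) < lev (N.tgt a))
    (c : N.Code) (i : ι) (a : N.A)
    (ha : ¬ ∀ x x' : ι → Bool, (∀ j, j ≠ i → x j = x' j) → c.val a x = c.val a x') :
    ∃ p : N.graph.Walk (N.source i) (N.tgt a), lev (N.source i) + p.length ≤ lev (N.tgt a) := by
  suffices h : ∀ (r : ℕ) (a : N.A), N.rank (N.src a) = r →
      (¬ ∀ x x' : ι → Bool, (∀ j, j ≠ i → x j = x' j) → c.val a x = c.val a x') →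
      ∃ p : N.graph.Walk (N.source i) (N.tgt a), lev (N.source i) + p.length ≤ lev (N.tgt a) from
    h _ a rfl ha
  intro r
  induction r using Nat.strong_induction_on with
  | _ r ih =>
    intro a hr hdep
    rcases codingVolume_dep_upstream c i a hdep with hsrc | ⟨b, hb, hdepb⟩
    · refine ⟨(SimpleGraph.Walk.cons (codingVolume_adj_arc a) SimpleGraph.Walk.nil).copy hsrc rfl, ?_⟩
      simp only [SimpleGraph.Walk.length_copy, SimpleGraph.Walk.length_cons,
        SimpleGraph.Walk.length_nil]
      have h1 := hlev a
      rw [hsrc] at h1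
      omega
    · have hlt : N.rank (N.src b) < r := by
        rw [← hr, ← hb]; exact N.rank_lt b
      obtain ⟨p, hp⟩ := ih _ hlt b rfl hdepb
      refine ⟨(p.copy rfl hb).concat (codingVolume_adj_arc a), ?_⟩
      simp only [SimpleGraph.Walk.length_concat, SimpleGraph.Walk.length_copy]
      have h1 := hlev a
      have h2 : lev (N.tgt b) = lev (N.src a) := congrArg lev hb
      omega

/-- For a strict potential `lev` and an `L`-far coded pair: `lev (source i) + L ≤ lev (sink i)` (apply
`codingVolume_exists_walk_lev` to an `x_i`-dependent arc into `sink i`; the walk has length `≥ L`).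
[folklore] -/
theorem codingVolume_lev_source_add_le (lev : N.V → ℕ) (hlev : ∀ a, lev (N.src a) < lev (N.tgt a))
    (c : N.Code) (i : ι) {L : ℕ} (hfar : (L : ℕ∞) ≤ N.graph.edist (N.source i) (N.sink i)) :
    lev (N.source i) + L ≤ lev (N.sink i) := by
  obtain ⟨b, hb, hdep⟩ := codingVolume_exists_dep_inArc_sink c i
  obtain ⟨p, hp⟩ := codingVolume_exists_walk_lev lev hlev c i b hdep
  have hL := codingVolume_le_length_of_far hfar (p.copy rfl hb)
  simp only [SimpleGraph.Walk.length_copy] at hL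
  have h2 : lev (N.tgt b) = lev (N.sink i) := congrArg lev hb
  omega

/-- Double counting of thresholds (bookkeeping): summing over `ρ < B` the number of `x` with
`p x < ρ ≤ q x` gives `Σ_x (q x − p x)` when all `q x < B`. [folklore] -/
theorem codingVolume_sum_card_filter_Ioc {X : Type} [Fintype X] (p q : X → ℕ) (B : ℕ)
    (hB : ∀ x, q x < B) :
    ∑ ρ ∈ range B, (univ.filter fun x => p x < ρ ∧ ρ ≤ q x).card = ∑ x, (q x - p x) := by
  classical
  calc ∑ ρ ∈ range B, (univ.filter fun x => p x < ρ ∧ ρ ≤ q x).card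
      = ∑ ρ ∈ range B, ∑ x, (if p x < ρ ∧ ρ ≤ q x then 1 else 0) := by
        simp_rw [Finset.card_filter]
    _ = ∑ x, ∑ ρ ∈ range B, (if p x < ρ ∧ ρ ≤ q x then 1 else 0) := Finset.sum_comm
    _ = ∑ x, ((range B).filter fun ρ => p x < ρ ∧ ρ ≤ q x).card := by
        simp_rw [Finset.card_filter]
    _ = ∑ x, (q x - p x) := Finset.sum_congr rfl fun x _ => by
        have h : (range B).filter (fun ρ => p x < ρ ∧ ρ ≤ q x) = Finset.Ioc (p x) (q x) := by
          ext ρ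
          simp only [Finset.mem_filter, Finset.mem_range, Finset.mem_Ioc]
          constructor
          · rintro ⟨-, h⟩
            exact h
          · intro h
            have := hB x
            exact ⟨by omega, h⟩
        rw [h, Nat.card_Ioc]

/-- **STRETCH BOUND.** In a k-pairs network with all pairs `L`-far and a binary one-shot code, every
strict potential `lev` on the vertices satisfies `L·k ≤ Σ_a (lev (tgt a) − lev (src a))`: for each
threshold `ρ` the cut-set bound (`codingVolume_cut_bound`) for the upper set `{v | ρ ≤ lev v}` bounds the
commodities with `lev (source i) < ρ ≤ lev (sink i)` by the arcs with `lev (src a) < ρ ≤ lev (tgt a)`;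
summing over `ρ`, each commodity is counted `lev (sink i) − lev (source i) ≥ L` times
(`codingVolume_lev_source_add_le`) and each arc its stretch many times. No degree bound. [folklore] -/
theorem codingVolume_mul_card_le_sum_stretch [Fintype ι] (N : KPairsNet ι) (lev : N.V → ℕ)
    (hlev : ∀ a, lev (N.src a) < lev (N.tgt a)) {L : ℕ} (hfar : N.Far L) (c : N.Code) :
    L * Fintype.card ι ≤ ∑ a, (lev (N.tgt a) - lev (N.src a)) := by
  classical
  set B : ℕ := univ.sup lev + 1 with hB
  have hltB : ∀ v, lev v < B := fun v =>
    Nat.lt_succ_of_le (Finset.le_sup (f := lev) (Finset.mem_univ v))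
  -- the cut-set bound across each threshold
  have hcut : ∀ ρ, (univ.filter fun i => lev (N.source i) < ρ ∧ ρ ≤ lev (N.sink i)).card ≤
      (univ.filter fun a => lev (N.src a) < ρ ∧ ρ ≤ lev (N.tgt a)).card := by
    intro ρ
    have h := codingVolume_cut_bound c (univ.filter fun v => ρ ≤ lev v)
    refine le_trans (le_of_eq ?_) (h.trans (le_of_eq ?_))
    · congr 1
      ext i
      simp only [Finset.mem_filter, Finset.mem_univ, true_and, not_le]
      exact and_comm
    · congr 1
      ext a
      simp only [Finset.mem_filter, Finset.mem_univ, true_and, not_le]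
  calc L * Fintype.card ι = ∑ _i : ι, L := by simp [mul_comm]
    _ ≤ ∑ i, (lev (N.sink i) - lev (N.source i)) := Finset.sum_le_sum fun i _ => by
        have := codingVolume_lev_source_add_le lev hlev c i (hfar i)
        omega
    _ = ∑ ρ ∈ range B, (univ.filter fun i => lev (N.source i) < ρ ∧ ρ ≤ lev (N.sink i)).card :=
        (codingVolume_sum_card_filter_Ioc _ _ B fun i => hltB _).symm
    _ ≤ ∑ ρ ∈ range B, (univ.filter fun a => lev (N.src a) < ρ ∧ ρ ≤ lev (N.tgt a)).card :=
        Finset.sum_le_sum fun ρ _ => hcut ρ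
    _ = ∑ a, (lev (N.tgt a) - lev (N.src a)) :=
        codingVolume_sum_card_filter_Ioc _ _ B fun a => hltB _

/-- The stretch bound for the network's own rank function: `L·k ≤ Σ_a (rank (tgt a) − rank (src a))`.
[folklore] -/
theorem codingVolume_mul_card_le_sum_rank_stretch [Fintype ι] (N : KPairsNet ι) {L : ℕ}
    (hfar : N.Far L) (c : N.Code) :
    L * Fintype.card ι ≤ ∑ a, (N.rank (N.tgt a) - N.rank (N.src a)) :=
  codingVolume_mul_card_le_sum_stretch N N.rank N.rank_lt hfar c

/-- **DEFICIT = LEVEL-SKIPPING.** Equivalently, for every strict potential `lev`: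
`L·k ≤ m + Σ_a (lev (tgt a) − lev (src a) − 1)` — whatever a coded `L`-far network saves on the routing
volume `L·k` is paid, arc by arc, by arcs that skip levels. [folklore] -/
theorem codingVolume_mul_card_le_arcCount_add_excess [Fintype ι] (N : KPairsNet ι) (lev : N.V → ℕ)
    (hlev : ∀ a, lev (N.src a) < lev (N.tgt a)) {L : ℕ} (hfar : N.Far L) (c : N.Code) :
    L * Fintype.card ι ≤ N.arcCount + ∑ a, (lev (N.tgt a) - lev (N.src a) - 1) := by
  have h := codingVolume_mul_card_le_sum_stretch N lev hlev hfar c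
  have hsplit : ∑ a, (lev (N.tgt a) - lev (N.src a)) =
      ∑ a : N.A, (1 + (lev (N.tgt a) - lev (N.src a) - 1)) :=
    Finset.sum_congr rfl fun a _ => by have := hlev a; omega
  rw [hsplit, Finset.sum_add_distrib] at h
  simpa [KPairsNet.arcCount] using h

/-- **GRADED NETWORKS (arc form): `L·k ≤ m`.** If some potential climbs EXACTLY one level along every
arc (a graded DAG, e.g. a layered network), then an `L`-far coded k-pairs network has at least `L·k`
arcs — the routing volume, with no degree bound: by the stretch bound every arc has stretch `1`.
[folklore] -/
theorem codingVolume_graded_arcs [Fintype ι] (N : KPairsNet ι) (lev : N.V → ℕ)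
    (hlev : ∀ a, lev (N.tgt a) = lev (N.src a) + 1) {L : ℕ} (hfar : N.Far L) (c : N.Code) :
    L * Fintype.card ι ≤ N.arcCount := by
  have h := codingVolume_mul_card_le_sum_stretch N lev
    (fun a => by rw [hlev a]; exact Nat.lt_succ_self _) hfar c
  simpa [hlev, KPairsNet.arcCount] using h

/-- **`CodingVolume` holds on graded networks, in the shape of the crux (stmt-PneNP-19454):** for all
`Δ, C` the distance `L := C` forces `C·k ≤ m` on every graded k-pairs DAG (some potential climbs one
level per arc) with a binary one-shot code — every cell of the ladder, optimal `L` (the tight path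
networks of `CodingVolume.Negative.codingVolume_ceiling` are graded), degree bound unused. What
separates this from X itself is exactly the level-skipping arcs of `codingVolume_mul_card_le_arcCount_add_excess`.
[folklore] -/
theorem codingVolume_graded : ∀ Δ C : ℕ, ∃ L : ℕ, ∀ (ι : Type) [Fintype ι] (N : KPairsNet ι),
    (∃ lev : N.V → ℕ, ∀ a, lev (N.tgt a) = lev (N.src a) + 1) →
    N.DegLE Δ → N.Far L → Nonempty N.Code → C * Fintype.card ι ≤ N.arcCount :=
  fun _ C => ⟨C, fun _ _ N ⟨lev, hlev⟩ _ hfar hc =>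
    hc.elim fun c => codingVolume_graded_arcs N lev hlev hfar c⟩

end Graded

end Summit.PneNP.PneNP.Theorems
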